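import Mathlib
import Summits.Ventures.PercRepro2.Defs
import Summits.Ventures.PercRepro2.Independence
import Summits.Ventures.PercRepro2.Harris
import Summits.Ventures.PercRepro2.Graph
import Summits.Ventures.PercRepro2.Events
import Summits.Ventures.PercRepro2.ZCZeroWeight
import Summits.Ventures.PercRepro2.ZCLeafReductionsP
import Summits.Ventures.PercRepro2.ZCLeafReductionsP2
import Summits.Ventures.PercRepro2.ZCLeafBuilt
import Summits.Ventures.PercRepro2.ZCInsertP
import Summits.Ventures.PercRepro2.ZCInsertP2

/-!
# The dismantling theorem with the two mirror insertions: (ZC) on every graph that can be stripped to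
nothing by leaves and the SIX degree-two placements of a mark with a mark neighbour
(blind cell PercRepro2, mine-a g25; MINE-A.md §74.7)

`ZCDismantle` (mine-a g24) proves (ZC) along a list of records of five kinds — the insertions E, F, G, H
and leaves.  With Theorems I and J in the kernel (`zc_oa3w_graph'`, `zc_a3ow_graph'`: `o` of degree two
between `a₃` and any `w`; `a₃` of degree two between `o` and any `w`) the same induction runs over
SEVEN kinds: `k : Fin 7`, kinds `0..3` and `4` as before, kind `5` = I (`v = o`, `f₁ = oa₃`, `f₂ = ow`;
the `o`-mark moves to `w`), kind `6` = J (`v = a₃`, `f₁ = a₃o`, `f₂ = a₃w`; the `a₃`-mark moves to `w`).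
The graph theorems I, J carry `[Fintype V]` (BHK06 avoidance), so does this file.  This file: the induction
`zc_of_dismantling₆`; the corollaries `zc_of_dismantling₆_all`, `zc_of_dismantling₆_all'` and
`zc_of_dismantling₆_coincide` are in `ZCDismantle6Cor`.  No definition; one seat.
-/

namespace Summit.Ventures.PercRepro2

section Dismantle6

variable {V : Type*} [DecidableEq V] [Fintype V] {E : Type*} [Fintype E] [DecidableEq E] {R : Type*}
  [CommRing R] [LinearOrder R] [IsStrictOrderedRing R]

/-- **(ZC) along a dismantling.**  A record is `(k, f₁, f₂, v, w, a₁, a₃, o)`: kinds `0..3` as in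
`zc_of_mixed_chain`, kind `4` a leaf `v` at `w` with `f₁ = f₂`. -/
theorem zc_of_dismantling₆ {ends : E → Sym2 V} (L : List (Fin 7 × E × E × V × V × V × V × V))
    (hrec : ∀ r ∈ L, ends r.2.2.1 = s(r.2.2.2.1, r.2.2.2.2.1) ∧
      ((r.1 = 0 ∧ r.2.1 ≠ r.2.2.1 ∧ r.2.2.2.1 = r.2.2.2.2.2.2.1 ∧ ends r.2.1 = s(r.2.2.2.1, r.2.2.2.2.2.1)
          ∧ r.2.2.2.1 ≠ r.2.2.2.2.2.1 ∧ r.2.2.2.1 ≠ r.2.2.2.2.2.2.2) ∨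
       (r.1 = 1 ∧ r.2.1 ≠ r.2.2.1 ∧ r.2.2.2.1 = r.2.2.2.2.2.1 ∧ ends r.2.1 = s(r.2.2.2.1, r.2.2.2.2.2.2.1)
          ∧ r.2.2.2.1 ≠ r.2.2.2.2.2.2.1 ∧ r.2.2.2.1 ≠ r.2.2.2.2.2.2.2) ∨
       (r.1 = 2 ∧ r.2.1 ≠ r.2.2.1 ∧ r.2.2.2.1 = r.2.2.2.2.2.2.2 ∧ ends r.2.1 = s(r.2.2.2.1, r.2.2.2.2.2.1)
          ∧ r.2.2.2.1 ≠ r.2.2.2.2.2.1 ∧ r.2.2.2.1 ≠ r.2.2.2.2.2.2.1) ∨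
       (r.1 = 3 ∧ r.2.1 ≠ r.2.2.1 ∧ r.2.2.2.1 = r.2.2.2.2.2.1 ∧ ends r.2.1 = s(r.2.2.2.1, r.2.2.2.2.2.2.2)
          ∧ r.2.2.2.1 ≠ r.2.2.2.2.2.2.1 ∧ r.2.2.2.1 ≠ r.2.2.2.2.2.2.2) ∨
       (r.1 = 5 ∧ r.2.1 ≠ r.2.2.1 ∧ r.2.2.2.1 = r.2.2.2.2.2.2.2 ∧ ends r.2.1 = s(r.2.2.2.1, r.2.2.2.2.2.2.1)
          ∧ r.2.2.2.1 ≠ r.2.2.2.2.2.1 ∧ r.2.2.2.1 ≠ r.2.2.2.2.2.2.1) ∨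
       (r.1 = 6 ∧ r.2.1 ≠ r.2.2.1 ∧ r.2.2.2.1 = r.2.2.2.2.2.2.1 ∧ ends r.2.1 = s(r.2.2.2.1, r.2.2.2.2.2.2.2)
          ∧ r.2.2.2.1 ≠ r.2.2.2.2.2.1 ∧ r.2.2.2.1 ≠ r.2.2.2.2.2.2.2) ∨
       (r.1 = 4 ∧ r.2.1 = r.2.2.1 ∧ r.2.2.2.1 ≠ r.2.2.2.2.1)))
    (hchain : List.IsChain (fun r r' => r'.2.2.2.2.2 =
      (if r.1 = 0 then (r.2.2.2.2.2.1, r.2.2.2.2.1, r.2.2.2.2.2.2.2)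
       else if r.1 = 2 then (r.2.2.2.2.2.1, r.2.2.2.2.2.2.1, r.2.2.2.2.1)
       else if r.1 = 4 then
         (if r.2.2.2.1 = r.2.2.2.2.2.1 then (r.2.2.2.2.1, r.2.2.2.2.2.2.1, r.2.2.2.2.2.2.2)
          else if r.2.2.2.1 = r.2.2.2.2.2.2.1 then (r.2.2.2.2.2.1, r.2.2.2.2.1, r.2.2.2.2.2.2.2)
          else if r.2.2.2.1 = r.2.2.2.2.2.2.2 then (r.2.2.2.2.2.1, r.2.2.2.2.2.2.1, r.2.2.2.2.1)
          else r.2.2.2.2.2)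
       else if r.1 = 5 then (r.2.2.2.2.2.1, r.2.2.2.2.2.2.1, r.2.2.2.2.1)
       else if r.1 = 6 then (r.2.2.2.2.2.1, r.2.2.2.2.1, r.2.2.2.2.2.2.2)
       else (r.2.2.2.2.1, r.2.2.2.2.2.2.1, r.2.2.2.2.2.2.2))) L)
    (hpair : L.Pairwise (fun r r' => r.2.2.2.1 ∉ ends r'.2.1 ∧ r.2.2.2.1 ∉ ends r'.2.2.1)) :
    ∀ (p : E → R), IsProbVec p →
    (∀ r ∈ L, ∀ e, r.2.2.2.1 ∈ ends e → (∃ r' ∈ L, e = r'.2.1 ∨ e = r'.2.2.1) ∨ p e = 0) →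
    ∀ (m : V × V × V) (𝓔 : Set (Set V)), IsUpperSet 𝓔 → (∀ r, L.head? = some r → r.2.2.2.2.2 = m) →
    (∀ 𝓔' : Set (Set V), IsUpperSet 𝓔' →
      let p₀ := L.foldl (fun q r => Function.update (Function.update q r.2.1 0) r.2.2.1 0) p
      let m' := L.foldl (fun (_ : V × V × V) r =>
        if r.1 = 0 then (r.2.2.2.2.2.1, r.2.2.2.2.1, r.2.2.2.2.2.2.2)
        else if r.1 = 2 then (r.2.2.2.2.2.1, r.2.2.2.2.2.2.1, r.2.2.2.2.1)
        else if r.1 = 4 then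
          (if r.2.2.2.1 = r.2.2.2.2.2.1 then (r.2.2.2.2.1, r.2.2.2.2.2.2.1, r.2.2.2.2.2.2.2)
           else if r.2.2.2.1 = r.2.2.2.2.2.2.1 then (r.2.2.2.2.2.1, r.2.2.2.2.1, r.2.2.2.2.2.2.2)
           else if r.2.2.2.1 = r.2.2.2.2.2.2.2 then (r.2.2.2.2.2.1, r.2.2.2.2.2.2.1, r.2.2.2.2.1)
           else r.2.2.2.2.2)
        else if r.1 = 5 then (r.2.2.2.2.2.1, r.2.2.2.2.2.2.1, r.2.2.2.2.1)
        else if r.1 = 6 then (r.2.2.2.2.2.1, r.2.2.2.2.1, r.2.2.2.2.2.2.2)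
        else (r.2.2.2.2.1, r.2.2.2.2.2.2.1, r.2.2.2.2.2.2.2)) m
      let e := connEvent ends m'.1 m'.2.1
      let L' := connEvent ends m'.1 m'.2.2
      let U := clusterInEvent ends m'.1 𝓔'
      let γ := connEvent ends m'.2.1 m'.2.2
      0 ≤ prob p₀ (eᶜ ∩ L'ᶜ ∩ γᶜ) * (prob p₀ (U ∩ (e ∩ L')) - prob p₀ U * prob p₀ (e ∩ L'))
        - prob p₀ (eᶜ ∩ L'ᶜ ∩ γ) * (prob p₀ (U ∩ (e ∩ L'ᶜ)) - prob p₀ U * prob p₀ (e ∩ L'ᶜ))) →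
    let e := connEvent ends m.1 m.2.1
    let L' := connEvent ends m.1 m.2.2
    let U := clusterInEvent ends m.1 𝓔
    let γ := connEvent ends m.2.1 m.2.2
    0 ≤ prob p (eᶜ ∩ L'ᶜ ∩ γᶜ) * (prob p (U ∩ (e ∩ L')) - prob p U * prob p (e ∩ L'))
      - prob p (eᶜ ∩ L'ᶜ ∩ γ) * (prob p (U ∩ (e ∩ L'ᶜ)) - prob p U * prob p (e ∩ L'ᶜ)) := by
  induction L with
  | nil =>
    intro p _ _ m 𝓔 h𝓔 _ hbase
    have h := hbase 𝓔 h𝓔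
    simpa using h
  | cons r L ih =>
    intro p hp hzero m 𝓔 h𝓔 hhead hbase
    obtain ⟨k, f₁, f₂, v, w, a₁, a₃, o⟩ := r
    have hm : (a₁, a₃, o) = m := hhead (k, f₁, f₂, v, w, a₁, a₃, o) rfl
    subst hm
    obtain ⟨hends₂, hkind⟩ := hrec (k, f₁, f₂, v, w, a₁, a₃, o) List.mem_cons_self
    simp only at hends₂ hkind
    have hrec' := fun r hr => hrec r (List.mem_cons_of_mem _ hr)
    have hchain' := hchain.tail
    have hpair' := (List.pairwise_cons.1 hpair).2
    have hhead' : ∀ r' ∈ L, v ∉ ends r'.2.1 ∧ v ∉ ends r'.2.2.1 := (List.pairwise_cons.1 hpair).1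
    have hmark : ∀ e, v ∈ ends e → e = f₁ ∨ e = f₂ ∨ p e = 0 := by
      intro e he
      rcases hzero (k, f₁, f₂, v, w, a₁, a₃, o) List.mem_cons_self e he with ⟨r', hr', h⟩ | h
      · rcases List.mem_cons.1 hr' with rfl | hr'
        · simp only at h
          rcases h with rfl | rfl
          · exact Or.inl rfl
          · exact Or.inr (Or.inl rfl)
        · exfalso
          rcases h with rfl | rfl
          · exact (hhead' r' hr').1 he
          · exact (hhead' r' hr').2 he
      · exact Or.inr (Or.inr h)
    -- the tail under `p[f₁, f₂ ↦ 0]`, for the moved marks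
    set p' := Function.update (Function.update p f₁ 0) f₂ 0 with hp'def
    have hp' : IsProbVec p' := (hp.update f₁ le_rfl zero_le_one).update f₂ le_rfl zero_le_one
    have hzero' : ∀ r ∈ L, ∀ e, r.2.2.2.1 ∈ ends e →
        (∃ r' ∈ L, e = r'.2.1 ∨ e = r'.2.2.1) ∨ p' e = 0 := by
      intro r hr e he
      rcases hzero r (List.mem_cons_of_mem _ hr) e he with ⟨r', hr', h⟩ | h
      · rcases List.mem_cons.1 hr' with rfl | hr'
        · right
          simp only at h
          rcases h with h | h
          · by_cases h12 : f₁ = f₂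
            · rw [h, h12, hp'def]; simp
            · rw [h, hp'def, Function.update_of_ne h12]; simp
          · rw [h, hp'def]; simp
        · exact Or.inl ⟨r', hr', h⟩
      · right
        by_cases h2 : e = f₂
        · subst h2; simp [hp'def]
        · by_cases h1 : e = f₁
          · subst h1; simp [hp'def, Function.update_of_ne h2]
          · rw [hp'def, Function.update_of_ne h2, Function.update_of_ne h1]; exact h
    -- the moved marks
    set m' : V × V × V := if k = 0 then (a₁, w, o) else if k = 2 then (a₁, a₃, w)
      else if k = 4 then (if v = a₁ then (w, a₃, o) else if v = a₃ then (a₁, w, o)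
        else if v = o then (a₁, a₃, w) else (a₁, a₃, o))
      else if k = 5 then (a₁, a₃, w) else if k = 6 then (a₁, w, o)
      else (w, a₃, o) with hm'def
    have hhead'' : ∀ r', L.head? = some r' → r'.2.2.2.2.2 = m' := by
      intro r' hr'
      exact (List.isChain_cons.1 hchain).1 r' hr'
    have hbase' : ∀ 𝓔' : Set (Set V), IsUpperSet 𝓔' →
        let p₀ := L.foldl (fun q r => Function.update (Function.update q r.2.1 0) r.2.2.1 0) p'
        let m'' := L.foldl (fun (_ : V × V × V) r =>
          if r.1 = 0 then (r.2.2.2.2.2.1, r.2.2.2.2.1, r.2.2.2.2.2.2.2)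
          else if r.1 = 2 then (r.2.2.2.2.2.1, r.2.2.2.2.2.2.1, r.2.2.2.2.1)
          else if r.1 = 4 then
            (if r.2.2.2.1 = r.2.2.2.2.2.1 then (r.2.2.2.2.1, r.2.2.2.2.2.2.1, r.2.2.2.2.2.2.2)
             else if r.2.2.2.1 = r.2.2.2.2.2.2.1 then (r.2.2.2.2.2.1, r.2.2.2.2.1, r.2.2.2.2.2.2.2)
             else if r.2.2.2.1 = r.2.2.2.2.2.2.2 then (r.2.2.2.2.2.1, r.2.2.2.2.2.2.1, r.2.2.2.2.1)
             else r.2.2.2.2.2)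
          else if r.1 = 5 then (r.2.2.2.2.2.1, r.2.2.2.2.2.2.1, r.2.2.2.2.1)
        else if r.1 = 6 then (r.2.2.2.2.2.1, r.2.2.2.2.1, r.2.2.2.2.2.2.2)
        else (r.2.2.2.2.1, r.2.2.2.2.2.2.1, r.2.2.2.2.2.2.2)) m'
        let e := connEvent ends m''.1 m''.2.1
        let L' := connEvent ends m''.1 m''.2.2
        let U := clusterInEvent ends m''.1 𝓔'
        let γ := connEvent ends m''.2.1 m''.2.2
        0 ≤ prob p₀ (eᶜ ∩ L'ᶜ ∩ γᶜ) * (prob p₀ (U ∩ (e ∩ L')) - prob p₀ U * prob p₀ (e ∩ L'))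
          - prob p₀ (eᶜ ∩ L'ᶜ ∩ γ) * (prob p₀ (U ∩ (e ∩ L'ᶜ)) - prob p₀ U * prob p₀ (e ∩ L'ᶜ)) := by
      intro 𝓔' h𝓔'
      have h := hbase 𝓔' h𝓔'
      simp only [List.foldl_cons] at h ⊢
      exact h
    have hIH := ih hrec' hchain' hpair' p' hp' hzero' m' _ (isUpperSet_rootShift h𝓔 v) hhead'' hbase'
    have hIHleaf := ih hrec' hchain' hpair' p' hp' hzero' m' _ (isUpperSet_leafShift h𝓔 w v) hhead'' hbase'
    have hIHsame := ih hrec' hchain' hpair' p' hp' hzero' m' 𝓔 h𝓔 hhead'' hbase'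
    simp only at hIH hIHleaf hIHsame
    simp only
    -- the step, by kind
    rcases hkind with ⟨hk, hf, hv, hends₁, hne₁, hne₂⟩ | ⟨hk, hf, hv, hends₁, hne₁, hne₂⟩
      | ⟨hk, hf, hv, hends₁, hne₁, hne₂⟩ | ⟨hk, hf, hv, hends₁, hne₁, hne₂⟩
      | ⟨hk, hf, hv, hends₁, hne₁, hne₂⟩ | ⟨hk, hf, hv, hends₁, hne₁, hne₂⟩ | ⟨hk, hf, hvw⟩
    · -- E
      subst hv
      simp only [hk, hm'def, if_true] at hIH
      exact zc_a3w_graph' hp hf hends₁ hends₂ hmark hne₁ hne₂ h𝓔 hIH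
    · -- F
      subst hv
      simp only [hk, hm'def, Fin.one_eq_zero_iff, if_false, show (1 : Fin 7) ≠ 2 by decide,
        show (1 : Fin 7) ≠ 4 by decide, show (1 : Fin 7) ≠ 5 by decide, show (1 : Fin 7) ≠ 6 by decide] at hIH
      by_cases h𝓔₁ : ({v} : Set V) ∈ 𝓔
      · have := zc_eq_zero_of_singleton_mem p ends v a₃ o h𝓔 h𝓔₁
        simp only at this
        rw [this]
      exact zc_rootw_graph' hp hf hends₁ hends₂ hmark hne₁ hne₂ h𝓔 h𝓔₁ hIH
    · -- G
      subst hv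
      simp only [hk, hm'def, show (2 : Fin 7) ≠ 0 by decide, if_false, if_true] at hIH
      exact zc_ow_graph' hp hf hends₁ hends₂ hmark hne₁ hne₂ h𝓔 hIH
    · -- H
      subst hv
      simp only [hk, hm'def, show (3 : Fin 7) ≠ 0 by decide, show (3 : Fin 7) ≠ 2 by decide,
        show (3 : Fin 7) ≠ 4 by decide, show (3 : Fin 7) ≠ 5 by decide, show (3 : Fin 7) ≠ 6 by decide,
        if_false] at hIH
      by_cases h𝓔₁ : ({v} : Set V) ∈ 𝓔
      · have := zc_eq_zero_of_singleton_mem p ends v a₃ o h𝓔 h𝓔₁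
        simp only at this
        rw [this]
      exact zc_rootow_graph' hp hf hends₁ hends₂ hmark hne₁ hne₂ h𝓔 h𝓔₁ hIH
    · -- I: `o` between `a₃` and `w`
      subst hv
      simp only [hk, hm'def, show (5 : Fin 7) ≠ 0 by decide, show (5 : Fin 7) ≠ 2 by decide,
        show (5 : Fin 7) ≠ 4 by decide, if_false, if_true] at hIH hIHsame
      exact zc_oa3w_graph' hp hf hends₁ hends₂ hmark hne₁ hne₂ h𝓔 hIHsame hIH
    · -- J: `a₃` between `o` and `w`
      subst hv
      simp only [hk, hm'def, show (6 : Fin 7) ≠ 0 by decide, show (6 : Fin 7) ≠ 2 by decide,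
        show (6 : Fin 7) ≠ 4 by decide, show (6 : Fin 7) ≠ 5 by decide, if_false, if_true] at hIH
      exact zc_a3ow_graph' hp hf hends₁ hends₂ hmark hne₁ hne₂ h𝓔 hIH
    · -- a leaf `v` at `w`, the single edge `f₁ = f₂`
      subst hf
      have hends : ends f₁ = s(w, v) := by rw [hends₂, Sym2.eq_swap]
      have hleaf : ∀ e, v ∈ ends e → e = f₁ ∨ p e = 0 := by
        intro e he
        rcases hmark e he with h | h | h
        · exact Or.inl h
        · exact Or.inl h
        · exact Or.inr h
      have hp'' : p' = Function.update p f₁ 0 := by rw [hp'def, Function.update_idem]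
      rw [hp''] at hIH hIHleaf hIHsame
      simp only [hk, hm'def, show (4 : Fin 7) ≠ 0 by decide, show (4 : Fin 7) ≠ 2 by decide,
        if_false, if_true] at hIH hIHleaf hIHsame
      have hpf : 0 ≤ p f₁ := hp.nonneg f₁
      by_cases hcoin : a₁ = a₃ ∨ a₁ = o ∨ a₃ = o
      · have := zc_eq_zero_of_coincide p ends a₁ a₃ o hcoin 𝓔
        simp only at this
        rw [this]
      have h13 : a₁ ≠ a₃ := fun h => hcoin (Or.inl h)
      have h1o : a₁ ≠ o := fun h => hcoin (Or.inr (Or.inl h))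
      have h3o : a₃ ≠ o := fun h => hcoin (Or.inr (Or.inr h))
      by_cases hv1 : v = a₁
      · subst hv1
        simp only [if_true] at hIH
        by_cases h𝓔₁ : ({v} : Set V) ∈ 𝓔
        · have := zc_eq_zero_of_singleton_mem p ends v a₃ o h𝓔 h𝓔₁
          simp only at this
          rw [this]
        have hred := zc_leaf_root_graph' hp hends hleaf h13 h1o hvw h𝓔 h𝓔₁ hIH
        simp only at hred
        exact le_trans (mul_nonneg hpf hIH) hred
      by_cases hv3 : v = a₃
      · subst hv3
        simp only [hv1, if_false, if_true] at hIHleaf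
        have hred := zc_leaf_a3_graph' hp hends hleaf (Ne.symm h13) h3o hvw h𝓔
        simp only at hred
        exact le_trans (mul_nonneg (mul_nonneg hpf hpf) hIHleaf) hred
      by_cases hvo : v = o
      · subst hvo
        simp only [hv1, hv3, if_false, if_true] at hIHleaf
        have hred := zc_leaf_o_graph' hp hends hleaf (Ne.symm h1o) (Ne.symm h3o) hvw h𝓔
        simp only at hred
        exact le_trans (mul_nonneg hpf hIHleaf) hred
      · simp only [hv1, hv3, hvo, if_false] at hIHleaf hIHsame
        have hred := zc_leaf_nonmark_graph' p hends hleaf hv1 hv3 hvo hvw 𝓔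
        simp only at hred
        rw [hred]
        exact add_nonneg (mul_nonneg (sub_nonneg.2 (hp.le_one f₁)) hIHsame) (mul_nonneg hpf hIHleaf)

end Dismantle6

end Summit.Ventures.PercRepro2
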